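import Mathlib

/-!
# A cubic with a non-real root has no root in a quadratic extension of a totally real field
(solo-Langlands-blind, s9)

Kernel anchor for FIELD LEMMA T1(b) / C22(a) of the dihedral door (HOME/paper/paper.md §4,
HOME/paper/dihedral-door.md 1.2): *a complex cubic field `K` (one real and one complex place) is
contained in no field `M` possessing a totally real subfield `M₀` with `[M : M₀] ≤ 2`* — so in no
totally real field, no CM field, and no quadratic extension of a totally real field. This is what
places the door's ground fields outside the regime of every construction of Galois representations
that needs a totally real or CM field, including the quadratic-over-totally-real case of
Boxer–Calegari–Gee–Pilloni (arXiv:1812.09269 §2.7).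

Proof: if `θ ∈ M` is a root of the irreducible cubic `f ∈ ℚ[X]`, its minimal polynomial over `M₀`
has degree `≤ [M : M₀] ≤ 2 < 3`, so `f` becomes reducible over `M₀`, hence (degree `3`) acquires a
root `β ∈ M₀`; then `f · c = minpoly_ℚ β` and every complex root of `f` is `φ(β)` for an embedding
`φ : M₀ → ℂ`, all of which are real — contradicting the existence of a non-real root.

Elementary field theory over Mathlib; no automorphic input.
-/

namespace Summit.Langlands.Langlands.Theorems.SoloBlind

open Polynomial NumberField

/-- In a totally real number field, every complex root of the minimal polynomial of an element is
real; hence an irreducible rational polynomial with a non-real complex root has no root in a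
totally real number field. -/
theorem no_root_in_totallyReal {M₀ : Type*} [Field M₀] [NumberField M₀] [IsTotallyReal M₀]
    (f : ℚ[X]) (hf : Irreducible f) (z : ℂ) (hz : aeval z f = 0) (hzim : z.im ≠ 0)
    (β : M₀) (hβ : aeval β f = 0) : False := by
  -- `minpoly ℚ β = f * C (leadingCoeff f)⁻¹`
  have hmin : f * C f.leadingCoeff⁻¹ = minpoly ℚ β := minpoly.eq_of_irreducible hf hβ
  have hβint : IsIntegral ℚ β := Algebra.IsIntegral.isIntegral β
  -- `z` is a root of `minpoly ℚ β` in `ℂ`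
  have hzroot : z ∈ (minpoly ℚ β).rootSet ℂ := by
    rw [Polynomial.mem_rootSet]
    refine ⟨minpoly.ne_zero hβint, ?_⟩
    rw [← hmin, map_mul, hz, zero_mul]
  -- hence `z = φ β` for some embedding `φ : M₀ →+* ℂ`, which is real
  rw [← NumberField.Embeddings.range_eval_eq_rootSet_minpoly M₀ ℂ β] at hzroot
  obtain ⟨φ, hφ⟩ := hzroot
  have hreal : ComplexEmbedding.IsReal φ := IsTotallyReal.complexEmbedding_isReal φ
  have hconj : starRingEnd ℂ (φ β) = φ β := by
    have := ComplexEmbedding.isReal_iff.mp hreal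
    rw [← ComplexEmbedding.conjugate_coe_eq, this]
  apply hzim
  rw [← hφ]
  exact Complex.conj_eq_iff_im.mp hconj

/-- **T1(b), polynomial form.** Let `f ∈ ℚ[X]` be irreducible of degree `3` with a non-real
complex root. If `M` is an extension of degree `≤ 2` of a totally real number field `M₀`, then `f`
has no root in `M`. -/
theorem no_root_of_cubic_in_quadratic_over_totallyReal
    {M₀ M : Type*} [Field M₀] [NumberField M₀] [IsTotallyReal M₀] [Field M] [CharZero M]
    [Algebra M₀ M] [FiniteDimensional M₀ M] (hdeg : Module.finrank M₀ M ≤ 2)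
    (f : ℚ[X]) (hf : Irreducible f) (hf3 : f.natDegree = 3)
    (z : ℂ) (hz : aeval z f = 0) (hzim : z.im ≠ 0)
    (θ : M) (hθ : aeval θ f = 0) : False := by
  -- the minimal polynomial of `θ` over `M₀` divides `f` and has degree `≤ 2`
  set F : M₀[X] := f.map (algebraMap ℚ M₀) with hF
  have hθint : IsIntegral M₀ θ := Algebra.IsIntegral.isIntegral θ
  have hFθ : aeval θ F = 0 := by rw [hF, aeval_map_algebraMap, hθ]
  have hdvd : minpoly M₀ θ ∣ F := minpoly.dvd M₀ θ hFθ
  have hle : (minpoly M₀ θ).natDegree ≤ 2 := (minpoly.natDegree_le θ).trans hdeg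
  have hFdeg : F.natDegree = 3 := by rw [hF, natDegree_map, hf3]
  -- so `F` is reducible over `M₀`
  have hFnotirr : ¬ Irreducible F := by
    intro hirr
    rcases hirr.dvd_iff.mp hdvd with hunit | hassoc
    · exact minpoly.not_isUnit M₀ θ hunit
    · have h1 := natDegree_eq_of_degree_eq (degree_eq_degree_of_associated hassoc)
      omega
  -- a reducible cubic over a field has a root
  have hroots : F.roots ≠ 0 := by
    intro h0
    exact hFnotirr ((irreducible_iff_roots_eq_zero_of_degree_le_three (by omega) (by omega)).mpr h0)
  obtain ⟨β, hβ⟩ := Multiset.exists_mem_of_ne_zero hroots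
  have hF0 : F ≠ 0 := by
    intro h; rw [h, natDegree_zero] at hFdeg; exact absurd hFdeg (by norm_num)
  have hβroot : aeval β f = 0 := by
    have := (mem_roots hF0).mp hβ
    rwa [IsRoot.def, hF, eval_map, ← aeval_def] at this
  exact no_root_in_totallyReal f hf z hz hzim β hβroot

/-- If `φ : K →+* ℂ` is a non-real embedding and `α` generates `K` over `ℚ` (power basis), then
`φ α` is non-real. -/
theorem im_gen_ne_zero_of_not_isReal {K : Type*} [Field K] [NumberField K]
    (pb : PowerBasis ℚ K) (φ : K →+* ℂ) (hφ : ¬ ComplexEmbedding.IsReal φ) :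
    (φ pb.gen).im ≠ 0 := by
  intro him
  apply hφ
  rw [ComplexEmbedding.isReal_iff]
  ext x
  rw [ComplexEmbedding.conjugate_coe_eq]
  obtain ⟨p, rfl⟩ := pb.exists_eq_aeval' x
  have hconjgen : starRingEnd ℂ (φ pb.gen) = φ pb.gen := Complex.conj_eq_iff_im.mpr him
  -- push `φ` and `conj` through `aeval` as `ℚ`-algebra maps
  have h1 : φ (aeval pb.gen p) = aeval (φ pb.gen) p := by
    have := Polynomial.aeval_algHom_apply φ.toRatAlgHom pb.gen p
    simpa using this.symm
  have h2 : starRingEnd ℂ (aeval (φ pb.gen) p) = aeval (starRingEnd ℂ (φ pb.gen)) p := by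
    have := Polynomial.aeval_algHom_apply (starRingEnd ℂ).toRatAlgHom (φ pb.gen) p
    simpa using this.symm
  rw [h1, h2, hconjgen]

/-- **T1(b), field form.** A cubic number field with a non-real embedding (a *complex cubic field*)
admits no ring homomorphism into any field `M` that is an extension of degree `≤ 2` of a totally
real number field `M₀`: it lies in no totally real field, no CM field, and no quadratic extension
of a totally real field. -/
theorem complexCubic_not_embeddable_quadratic_over_totallyReal
    {K : Type*} [Field K] [NumberField K] (hK3 : Module.finrank ℚ K = 3)
    (hKc : ∃ φ : K →+* ℂ, ¬ ComplexEmbedding.IsReal φ)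
    {M₀ M : Type*} [Field M₀] [NumberField M₀] [IsTotallyReal M₀] [Field M] [CharZero M]
    [Algebra M₀ M] [FiniteDimensional M₀ M] (hdeg : Module.finrank M₀ M ≤ 2)
    (i : K →+* M) : False := by
  obtain ⟨φ, hφ⟩ := hKc
  let pb : PowerBasis ℚ K := Field.powerBasisOfFiniteOfSeparable ℚ K
  set f : ℚ[X] := minpoly ℚ pb.gen with hf
  have hgenint : IsIntegral ℚ pb.gen := Algebra.IsIntegral.isIntegral pb.gen
  have hirr : Irreducible f := minpoly.irreducible hgenint
  have hf3 : f.natDegree = 3 := by rw [hf, pb.natDegree_minpoly, ← pb.finrank, hK3]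
  -- the non-real root `φ(gen)`
  have hz : aeval (φ pb.gen) f = 0 := by
    have := Polynomial.aeval_algHom_apply φ.toRatAlgHom pb.gen f
    simp only [RingHom.toRatAlgHom_apply] at this
    rw [this, hf, minpoly.aeval, map_zero]
  have hzim : (φ pb.gen).im ≠ 0 := im_gen_ne_zero_of_not_isReal pb φ hφ
  -- the root `i(gen)` in `M`
  have hθ : aeval (i pb.gen) f = 0 := by
    have := Polynomial.aeval_algHom_apply i.toRatAlgHom pb.gen f
    simp only [RingHom.toRatAlgHom_apply] at this
    rw [this, hf, minpoly.aeval, map_zero]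
  exact no_root_of_cubic_in_quadratic_over_totallyReal hdeg f hirr hf3 (φ pb.gen) hz hzim
    (i pb.gen) hθ

/-- Corollary in the shape used by the door: a complex cubic field is not totally real, and admits
no embedding into a totally real number field (take `M = M₀`). -/
theorem complexCubic_not_embeddable_totallyReal
    {K : Type*} [Field K] [NumberField K] (hK3 : Module.finrank ℚ K = 3)
    (hKc : ∃ φ : K →+* ℂ, ¬ ComplexEmbedding.IsReal φ)
    {M₀ : Type*} [Field M₀] [NumberField M₀] [IsTotallyReal M₀] (i : K →+* M₀) : False :=
  complexCubic_not_embeddable_quadratic_over_totallyReal hK3 hKc (M₀ := M₀) (M := M₀)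
    (by rw [Module.finrank_self]; norm_num) i

end Summit.Langlands.Langlands.Theorems.SoloBlind
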